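import Literature.NumberTheory.Automorphic.CompletedCohomology
import Literature.NumberTheory.Automorphic.HidaTowerCentralHecke
import Literature.NumberTheory.Automorphic.HidaTowerDiamondContinuity
import HarnessLib

/-!
# `TwoAdicBianchiProModularityLevel` (crux stmt-Langlands-15110, route `ParityBlindBianchi`),
# negative side — the CENTRE CONSTRAINT on points of `Spf 𝕋(Kᵖ)`

The conclusion of the crux is an `IsHeckePoint` statement for the Hecke family `T_{v,1}, T_{v,2}`
(`v` good) of the `2`-power Bianchi tower, with `T_{v,2}` the double coset of the CENTRAL element
`diag(ϖ_v, ϖ_v)` of `GL₂(𝔸_K^∞)`.  The one family of relations in the big Hecke algebra that is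
explicit without computing any Bianchi cohomology is the centre constraint: `Z(𝔸_K^∞)` acts on every
`H^i(X_{K(s)}, 𝒪/2^t)` through the quotient `Z(𝔸_K^∞) / Z(K)·(Z ∩ K(s))`, because an element of the
level acts as the identity (`[L u L] = [L]`, tree `BigHeckeGLn.heckeEnd_eq_id_of_mem`) and a GLOBAL
central element `ι(γ)`, `γ ∈ Z(Γ)`, acts as the identity as well (tree `heckeEnd_eq_id_of_central`:
its double-coset operator is the translation by the central `γ⁻¹` on the coefficients, and central
elements of a group act trivially on its cohomology, tree
`Literature.Algebra.Homology.map_eq_id_of_central`).  This file assembles these into the constraint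
on POINTS of the big Hecke algebra of a tower (`CompletedCohomology.IsHeckePoint`), and specialises
it to the crux's own Hecke family:

* §1 `towerHeckeFamily_eq_one_of_central`, `towerHeckeFamily_eq_one_of_mem`,
  `towerHeckeFamily_mul_of_conj`, `towerHeckeFamily_list_prod_of_conj` — the diagonal Hecke families
  (all degrees, levels and coefficient depths at once) of level-normalising elements are
  multiplicative, and those of global central / level elements are `1` (generic `LevelTower`; the
  tree had the Hida-tower case `hidaFamily_*`);
* §1 `IsHeckePoint.list_prod_sub_one_mem` — **the centre constraint**: if `δ j₁ ⋯ δ j_m` (each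
  `δ jᵢ` normalising every level, e.g. central) equals `ι(γ) · u` with `γ ∈ Z(Γ)`, `ι γ ∈ Z(𝒢)` and
  `u` in every level, then every point `χ` of `Spf 𝕋(Kᵖ)` has `χ j₁ ⋯ χ j_m ≡ 1 (mod ϖ^t)` for all
  `t` (so `= 1` when `⋂_t (ϖ^t) = 0`): the `T_{v,2}`-values of a point form a character of the
  quotient of the centre by the global centre and the levels;
* §2 the crux's elements: `(t_{v,2})_f = diag(ϖ_v, ϖ_v)` is central in `GL₂(𝔸_K^∞)`
  (`sndHom_heckeDiagAt_two_mem_center`; the tree's `heckeDiagAt_self_mem_center` is the statement in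
  `GL₂(𝔸_K)`), and `crux_centre_constraint`: for the crux's `Γ = GL₂(K) → 𝒢 = GL₂(𝔸_K^∞)`, its Hecke
  family and values `a`, and ANY tower, a product of `diag(ϖ_v, ϖ_v)` over a list `l` of good places
  equal to `(x · 1) · u` (`x ∈ Kˣ`, `u` in every level) forces `∏_{v ∈ l} a_{v,2} ≡ 1 (mod ϖ₀^t)`.

For the Hansen data of `σ` (`a_{v,2} = det σ(Frob_v⁻¹)/q_v`) the constraint reads
`(det σ)(x) · N_{K/ℚ}(x)⁻¹ ≡ 1 (mod 2^t)` for `x ≡ 1` to depth `t` at the bad places, which HOLDS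
(`det σ` is a finite-order idele class character unramified at the good places, trivial on the
connected `ℂˣ`; `N(x) ≡ 1 mod 2^t`): the centre constraint does not refute the crux — it is the formal
shadow of "the central character of the sought `2`-adic avatar of `σ` is the `2`-adically continuous
idele class character `(det σ) · N⁻¹`", a necessary condition that any proof of stub B
(`stub_artinLift`, big `R = 𝕋` at `p = 2`) realises and any refutation must respect.
Lead c8 of line `Sketch`, cycle 9; sorry-free and definition-free.
-/

noncomputable section

set_option linter.dupNamespace false

namespace Summit.Langlands.Langlands.Theorems.TwoAdicBianchiProModularityLevel.Negative

open Literature.NumberTheory.Automorphic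

universe v

/-! ## §1. Hecke families of central and level elements; the centre constraint -/

section Hecke

-- Universe note: the tree's finite-level Hecke lemmas (`heckeEnd_eq_id_of_central`,
-- `heckeEnd_mul_of_conj`, `heckeEnd_eq_id_of_mem`) are stated in `Type`, as are all the crux's objects.
variable (k : Type) [CommRing k] {Γ 𝒢 : Type} [Group Γ] [Group 𝒢] (ι : Γ →* 𝒢)
  (T : LevelTower 𝒢) (ϖ : k)

/-- The diagonal Hecke family of a global central element is `1` (tree `heckeEnd_eq_id_of_central`,
degree by degree and level by level). [folklore] -/
theorem towerHeckeFamily_eq_one_of_central {γ : Γ} (hγ : γ ∈ Subgroup.center Γ)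
    (hιγ : ι γ ∈ Subgroup.center 𝒢) : towerHeckeFamily k ι T ϖ (ι γ) = 1 :=
  funext fun x => heckeEnd_eq_id_of_central k ι (T.level x.2.1) (modPow k ϖ x.2.2) hγ hιγ x.1

/-- The diagonal Hecke family of an element lying in every level of the tower is `1`
(`[L u L] = [L]`, tree `BigHeckeGLn.heckeEnd_eq_id_of_mem`). [folklore] -/
theorem towerHeckeFamily_eq_one_of_mem {u : 𝒢} (hu : ∀ s, u ∈ T.level s) :
    towerHeckeFamily k ι T ϖ u = 1 :=
  funext fun x => BigHeckeGLn.heckeEnd_eq_id_of_mem k ι (modPow k ϖ x.2.2) (hu x.2.1) x.1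

/-- The diagonal Hecke families of elements normalising every level of the tower are
multiplicative (tree `ArithmeticQuotient.heckeEnd_mul_of_conj`, degree by degree). [folklore] -/
theorem towerHeckeFamily_mul_of_conj {g g' : 𝒢} (hg : ∀ s, ∀ l ∈ T.level s, g⁻¹ * l * g ∈ T.level s)
    (hg' : ∀ s, ∀ l ∈ T.level s, g'⁻¹ * l * g' ∈ T.level s) :
    towerHeckeFamily k ι T ϖ (g * g') = towerHeckeFamily k ι T ϖ g * towerHeckeFamily k ι T ϖ g' :=
  funext fun x => ArithmeticQuotient.heckeEnd_mul_of_conj k ι (modPow k ϖ x.2.2) (hg x.2.1) (hg' x.2.1) x.1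

omit [Group Γ] in
/-- A product of level-normalising elements normalises every level. [folklore] -/
theorem list_prod_conj_mem (l : List 𝒢) (hl : ∀ g ∈ l, ∀ s, ∀ x ∈ T.level s, g⁻¹ * x * g ∈ T.level s) :
    ∀ s, ∀ x ∈ T.level s, (l.prod)⁻¹ * x * l.prod ∈ T.level s := by
  induction l with
  | nil => intro s x hx; simpa using hx
  | cons g l ih =>
    intro s x hx
    have h1 := hl g (List.mem_cons_self ..) s x hx
    have h2 := ih (fun g' hg' => hl g' (List.mem_cons_of_mem g hg')) s _ h1
    rw [List.prod_cons]
    rwa [show (g * l.prod)⁻¹ * x * (g * l.prod) = (l.prod)⁻¹ * (g⁻¹ * x * g) * l.prod by group]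

/-- The diagonal Hecke family of a product of level-normalising elements is the product of the
families (`T_1 = 1`, tree `ArithmeticQuotient.heckeEnd_one`, for the empty product). [folklore] -/
theorem towerHeckeFamily_list_prod_of_conj (l : List 𝒢)
    (hl : ∀ g ∈ l, ∀ s, ∀ x ∈ T.level s, g⁻¹ * x * g ∈ T.level s) :
    towerHeckeFamily k ι T ϖ l.prod = (l.map (towerHeckeFamily k ι T ϖ)).prod := by
  induction l with
  | nil =>
    rw [List.prod_nil, List.map_nil, List.prod_nil]
    exact funext fun x => ArithmeticQuotient.heckeEnd_one k ι (T.level x.2.1) (modPow k ϖ x.2.2) x.1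
  | cons g l ih =>
    have hl' : ∀ g' ∈ l, ∀ s, ∀ x ∈ T.level s, g'⁻¹ * x * g' ∈ T.level s :=
      fun g' hg' => hl g' (List.mem_cons_of_mem g hg')
    rw [List.prod_cons, List.map_cons, List.prod_cons,
      towerHeckeFamily_mul_of_conj k ι T ϖ (hl g (List.mem_cons_self ..)) (list_prod_conj_mem T l hl'),
      ih hl']

variable {J : Type v} (δ : J → 𝒢) (χ : J → k)

/-- **The centre constraint on points of `Spf 𝕋(Kᵖ)`.**  Let `χ` be a point of the big Hecke
algebra of the tower (`IsHeckePoint`).  If a product `δ j₁ ⋯ δ j_m` of Hecke elements, each of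
which normalises every level `K(s)` (e.g. central elements of `𝒢`, such as the `diag(ϖ_v, ϖ_v)`
behind `T_{v,2}`), is of the form `ι(γ) · u` with `γ` central in `Γ`, `ι γ` central in `𝒢` and `u`
in every level, then `∏ T_{δ jᵢ} = T_{ι γ} T_u = 1` in `𝕋(Kᵖ)` (`towerHeckeFamily_eq_one_of_central`,
`towerHeckeFamily_eq_one_of_mem`, multiplicativity), hence — applying the stage-`t` algebra map
`𝕋(Kᵖ) → k/ϖ^t` of the point — `χ j₁ ⋯ χ j_m ≡ 1 (mod ϖ^t)` for every `t`. [folklore] -/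
theorem IsHeckePoint.list_prod_sub_one_mem (h : IsHeckePoint ι T ϖ δ χ) (l : List J)
    (hl : ∀ j ∈ l, ∀ s, ∀ x ∈ T.level s, (δ j)⁻¹ * x * δ j ∈ T.level s)
    {γ : Γ} (hγ : γ ∈ Subgroup.center Γ) (hιγ : ι γ ∈ Subgroup.center 𝒢)
    {u : 𝒢} (hu : ∀ s, u ∈ T.level s) (hprod : (l.map δ).prod = ι γ * u) (t : ℕ) :
    (l.map χ).prod - 1 ∈ Ideal.span {ϖ ^ t} := by
  obtain ⟨I, φ, -, hφ⟩ := h t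
  -- the product of the generators `T_{δ j}`, `j ∈ l`, inside the big Hecke algebra is `1`
  let gen : J → bigHeckeAlgebra k ι T ϖ δ := fun j =>
    ⟨towerHeckeFamily k ι T ϖ (δ j), towerHeckeFamily_mem_bigHeckeAlgebra k ι T ϖ δ j⟩
  have hcoe : ∀ l' : List J, ((l'.map gen).prod : bigHeckeAlgebra k ι T ϖ δ).1 =
      ((l'.map δ).map (towerHeckeFamily k ι T ϖ)).prod := by
    intro l'
    induction l' with
    | nil => rfl
    | cons j l' ih =>
      rw [List.map_cons, List.prod_cons, List.map_cons, List.map_cons, List.prod_cons, ← ih]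
      rfl
  have hone : ((l.map gen).prod : bigHeckeAlgebra k ι T ϖ δ) = 1 := by
    refine Subtype.ext ?_
    rw [hcoe, ← towerHeckeFamily_list_prod_of_conj k ι T ϖ (l.map δ)
      (fun g hg => by obtain ⟨j, hj, rfl⟩ := List.mem_map.mp hg; exact hl j hj), hprod,
      towerHeckeFamily_mul_of_conj k ι T ϖ (fun s x hx => conj_mem_of_mem_center (T.level s) hιγ x hx)
        (fun s x hx => mul_mem (mul_mem (inv_mem (hu s)) hx) (hu s)),
      towerHeckeFamily_eq_one_of_central k ι T ϖ hγ hιγ, towerHeckeFamily_eq_one_of_mem k ι T ϖ hu,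
      one_mul]
    rfl
  have hφprod : φ (l.map gen).prod = Ideal.Quotient.mk (Ideal.span {ϖ ^ t}) (l.map χ).prod := by
    rw [map_list_prod, map_list_prod, List.map_map, List.map_map]
    congr 1
    exact List.map_congr_left fun j _ => hφ j
  rw [hone, map_one] at hφprod
  rw [← Ideal.Quotient.eq, map_one]
  exact hφprod.symm

/-- Single-element form of the centre constraint: if `δ j = ι(γ) · u` (`γ ∈ Z(Γ)`, `ι γ ∈ Z(𝒢)`,
`u` in every level) then `χ j ≡ 1 (mod ϖ^t)` for every point `χ` and every `t`. [folklore] -/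
theorem IsHeckePoint.sub_one_mem (h : IsHeckePoint ι T ϖ δ χ) (j : J)
    {γ : Γ} (hγ : γ ∈ Subgroup.center Γ) (hιγ : ι γ ∈ Subgroup.center 𝒢)
    {u : 𝒢} (hu : ∀ s, u ∈ T.level s) (hj : δ j = ι γ * u) (t : ℕ) :
    χ j - 1 ∈ Ideal.span {ϖ ^ t} := by
  have hnorm : ∀ s, ∀ x ∈ T.level s, (δ j)⁻¹ * x * δ j ∈ T.level s := fun s x hx => by
    rw [hj, mul_inv_rev, show u⁻¹ * (ι γ)⁻¹ * x * (ι γ * u) = u⁻¹ * ((ι γ)⁻¹ * x * ι γ) * u by group]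
    exact mul_mem (mul_mem (inv_mem (hu s)) (conj_mem_of_mem_center (T.level s) hιγ x hx)) (hu s)
  simpa using IsHeckePoint.list_prod_sub_one_mem k ι T ϖ δ χ h [j] (fun j' hj' => by
    obtain rfl : j' = j := List.mem_singleton.mp hj'; exact hnorm) hγ hιγ hu (by simpa using hj) t

end Hecke

/-! ## §2. The crux's own Hecke elements -/

section Crux

open scoped NumberField
open IsDedekindDomain

variable (K : Type) [Field K] [NumberField K]

/-- A unit whose underlying matrix is scalar lies in the centre of `GL_n(R)` (`R` commutative).
[folklore] -/
theorem mem_center_of_coe_eq_scalar {n : Type*} [Fintype n] [DecidableEq n] {R : Type*} [CommRing R]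
    (g : GL n R) (hg : ∃ r : R, (g : Matrix n n R) = Matrix.scalar n r) :
    g ∈ Subgroup.center (GL n R) := by
  obtain ⟨r, hr⟩ := hg
  rw [Subgroup.mem_center_iff]
  intro h
  refine Matrix.GeneralLinearGroup.ext fun i j => ?_
  have hc := (Matrix.scalar_commute r (fun r' => Commute.all r r') (h : Matrix n n R)).eq
  change ((h : Matrix n n R) * (g : Matrix n n R)) i j = ((g : Matrix n n R) * (h : Matrix n n R)) i j
  rw [hr, hc]

/-- **The element behind `T_{v,2}` is central**: `(t_{v,2})_f = diag(ϖ_v, ϖ_v)` (the idele of `ϖ`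
at `v`, `1` elsewhere, on both diagonal entries) is a scalar of `𝒢 = GL₂(𝔸_K^∞)`, in particular it
normalises every level of every tower (cf. the tree's `heckeDiagAt_self_mem_center` for `t_{v,n}`
in `GL_n(𝔸_K)`). [folklore] -/
theorem sndHom_heckeDiagAt_two_mem_center (v : HeightOneSpectrum (𝓞 K)) (ϖ : (v.adicCompletion K)ˣ) :
    GLn.sndHom 2 K (heckeDiagAt 2 K v ϖ 2) ∈ Subgroup.center (GL (Fin 2) (FiniteAdeleRing (𝓞 K) K)) := by
  refine mem_center_of_coe_eq_scalar _
    ⟨((uniformizerIdele K v ϖ : (FiniteAdeleRing (𝓞 K) K)ˣ) : FiniteAdeleRing (𝓞 K) K),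
      Matrix.ext fun i j => ?_⟩
  rw [Matrix.GeneralLinearGroup.map_apply]
  simp only [heckeDiagAt, coe_glDiagonal, Fin.is_lt, if_true, Matrix.diagonal_apply, Matrix.scalar_apply]
  by_cases hij : i = j
  · subst hij
    simp only [if_true, Units.coe_map]
    rfl
  · simp [hij]

variable {k : Type} [CommRing k] (ϖ₀ : k) (T : LevelTower (GL (Fin 2) (FiniteAdeleRing (𝓞 K) K)))
  {S : Type} (pl : S → HeightOneSpectrum (𝓞 K))
  (ϖ : ∀ v : HeightOneSpectrum (𝓞 K), (v.adicCompletion K)ˣ) (a : S → ℕ → k)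

/-- **The centre constraint for the crux's Hecke family.**  In the setting of the conclusion of
`TwoAdicBianchiProModularityLevel` — `Γ = GL₂(K) → 𝒢 = GL₂(𝔸_K^∞)` diagonally (the tree's
`globalEmbedding 2 K`, definitionally), ANY tower of levels `T` (for the crux `K(s) = U ∩ K((2)^s)`),
the Hecke family `(v, i) ↦ (t_{v,i+1})_f` over a type `S` of places (for the crux the good places,
`pl = Subtype.val`) with values `(v, i) ↦ a v (i+1)`, any coefficient ring `k` and `ϖ₀` (for the
crux `𝒪_{ℚ̄₂}` and `2`): if `a` is a point of `Spf 𝕋` (`IsHeckePoint`) and the product of the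
central elements `diag(ϖ_v, ϖ_v)` over a list `l` of places equals `(x · 1) · u` with `x ∈ Kˣ` and
`u` in every level, then `∏_{v ∈ l} a_{v,2} ≡ 1 (mod ϖ₀^t)` for every `t`.  (Which lists admit
such `x, u` — those whose idele `∏ ϖ_v` is principal up to a unit idele in `⋂_s Z ∩ K(s)` — is
class-field-theoretic bookkeeping not formalised here.) [folklore] -/
theorem crux_centre_constraint
    (hpt : IsHeckePoint
      (Matrix.GeneralLinearGroup.map (algebraMap K (FiniteAdeleRing (𝓞 K) K)) :
        GL (Fin 2) K →* GL (Fin 2) (FiniteAdeleRing (𝓞 K) K))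
      T ϖ₀
      (fun j : S × Fin 2 => GLn.sndHom 2 K (heckeDiagAt 2 K (pl j.1) (ϖ (pl j.1)) (j.2.val + 1)))
      (fun j => a j.1 (j.2.val + 1)))
    (l : List S) (x : Kˣ) (u : GL (Fin 2) (FiniteAdeleRing (𝓞 K) K)) (hu : ∀ s, u ∈ T.level s)
    (hprod : (l.map fun v => GLn.sndHom 2 K (heckeDiagAt 2 K (pl v) (ϖ (pl v)) 2)).prod =
      Matrix.GeneralLinearGroup.map (algebraMap K (FiniteAdeleRing (𝓞 K) K))
        (Matrix.GeneralLinearGroup.scalar (Fin 2) x) * u)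
    (t : ℕ) :
    (l.map fun v => a v 2).prod - 1 ∈ Ideal.span {ϖ₀ ^ t} := by
  have h := IsHeckePoint.list_prod_sub_one_mem k
    (Matrix.GeneralLinearGroup.map (algebraMap K (FiniteAdeleRing (𝓞 K) K)) :
      GL (Fin 2) K →* GL (Fin 2) (FiniteAdeleRing (𝓞 K) K))
    T ϖ₀ (fun j : S × Fin 2 => GLn.sndHom 2 K (heckeDiagAt 2 K (pl j.1) (ϖ (pl j.1)) (j.2.val + 1)))
    (fun j => a j.1 (j.2.val + 1)) hpt (l.map fun v => (v, (1 : Fin 2)))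
    (fun j hj s x hx => by
      obtain ⟨v, -, rfl⟩ := List.mem_map.mp hj
      exact conj_mem_of_mem_center (T.level s) (sndHom_heckeDiagAt_two_mem_center K (pl v) (ϖ (pl v))) x hx)
    (glScalar_mem_center x) (globalEmbedding_scalar_mem_center (n := 2) x) hu
    (by simpa [List.map_map, Function.comp_def] using hprod) t
  simpa [List.map_map, Function.comp_def] using h

end Crux

end Summit.Langlands.Langlands.Theorems.TwoAdicBianchiProModularityLevel.Negative

end
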